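import Summits.KontsevichZagierPeriods.KontsevichZagierPeriods.Theses.HurwitzMicroSectors
import Summits.KontsevichZagierPeriods.KontsevichZagierPeriods.Theorems.HurwitzMicroSectorsNormalFormPrinciplePiBoxTransfer
import Summits.KontsevichZagierPeriods.KontsevichZagierPeriods.Theorems.HurwitzMicroSectorsNormalFormPrincipleVariants2337
import Summits.KontsevichZagierPeriods.KontsevichZagierPeriods.Theorems.HurwitzMicroSectorsNormalFormPrincipleVariants2340

/-! TTRL-lite variant V2342 of stmt-KontsevichZagierPeriods-3869

Variant V2342 = `stub_boxRigidity` (BoxRigidity: two box-rational representations — domain the open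
unit box, integrand `p/q` over `ℚ` — with equal values are KZ-equivalent) under the JOINT small-case
move `bound_nat:m≤4; bound_nat:m'≤2`. Verdict of the attempt seat: **open** — this file is the
exact-strength certificate, not a proof of the variant. Every joint bound `m ≤ j, m' ≤ k` of the leaf
is worth exactly BoxVanishing up to dimension `max j k` (`boxRigidityLe_iff_boxVanishingLe`, file
`…Variants2340`) and that in turn is BoxVanishing in the single dimension `max j k`
(`boxRigidityLe_iff_boxVanishingAt`, file `…Variants2337`); here `max 4 2 = 4`, so

* `V2342 ⟺ BoxVanishing(dim ≤ 4) ⟺ BoxVanishing(4) ⟺ BoxRigidity(m, m' ≤ 4)`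
  (`stub_boxRigidity_var2342_iff_boxVanishingLe_four`, `…_iff_boxVanishing_four`, `…_iff_le_four`):
  the bound `m' ≤ 2` is idle next to `m ≤ 4`, and the variant is precisely Conjecture 1 for ALL
  box-rational periods of dimension `≤ 4` (`ζ(3)`, `ζ(4)` against `ζ(2)²`, Catalan's `G`, `π log 2`,
  `Li₂`/`Li₃`/`Li₄` values, …); it sits between the recorded-open rungs `≤ 3` (V2340/V2349/V2350, implied:
  `stub_boxRigidity_var2340_of_var2342`) and `≤ 5` (V2343); already its dimension-`2` consequence
  (`boxVanishing_two_of_stub_boxRigidity_var2342`) is the first open dimension (V2337/V2338), the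
  proved frontier being `max j k ≤ 1` (`boxRigidityLe_of_max_le_one`, Baker);
* `KontsevichZagierPeriods → V2342` (`stub_boxRigidity_var2342_of_statement`): a refutation of the
  variant would refute the Summit for the tree's calculus, and no invariant of the four moves finer
  than `eval` is known.
Source: M. Kontsevich, D. Zagier, *Periods* (2001), §1.2 Conjecture 1 and rules 1)–3).
Pure proof file, no definitions. -/

-- `Summit.<Summit>.<Problem>` is the tree's mandated summit-side namespace (CONVENTIONS §2); for this
-- single-conjunct summit the two coincide, so the duplicate is deliberate.
set_option linter.dupNamespace false

noncomputable section

namespace Summit.KontsevichZagierPeriods.KontsevichZagierPeriods.Theorems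

open MeasureTheory Set
open Literature.NumberTheory.Transcendental Literature.NumberTheory.Transcendental.KZ
open Summit.KontsevichZagierPeriods.KontsevichZagierPeriods.Theses.HurwitzMicroSectors
open Summit.KontsevichZagierPeriods.HurwitzMicroSectors.NormalFormPrinciple.PiBox

/-! ## The variant V2342: exactly Conjecture 1 for box-rational periods of dimension `≤ 4` -/

/-- **V2342 ⟺ BoxVanishing(dim ≤ 4)** (instance `j = 4, k = 2` of `boxRigidityLe_iff_boxVanishingLe`):
the variant is exactly "every rational function over `ℚ` on `(0,1)^m`, `m ≤ 4`, absolutely integrable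
with integral `0`, is a KZ relation". [cite: KontsevichZagier2001, §1.2 Conjecture 1] -/
theorem stub_boxRigidity_var2342_iff_boxVanishingLe_four :
    (∀ (m m' : ℕ) (N : IntegralRep m) (N' : IntegralRep m'), m ≤ 4 → m' ≤ 2 → N.domain = {x | ∀ i, x i ∈ Set.Ioo (0:ℝ) 1} → N.IsRational → N'.domain = {x | ∀ i, x i ∈ Set.Ioo (0:ℝ) 1} → N'.IsRational → N.value = N'.value → Equivalent N N') ↔
    (∀ (m : ℕ) (N : IntegralRep m), m ≤ 4 → N.domain = {x | ∀ i, x i ∈ Set.Ioo (0:ℝ) 1} →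
      N.IsRational → N.value = 0 → of N ∈ relations) :=
  boxRigidityLe_iff_boxVanishingLe 4 2

/-- **V2342 ⟺ BoxRigidity(m, m' ≤ 4)**: the bound `m' ≤ 2` is idle next to `m ≤ 4` (instance of
`boxRigidityLe_iff_max`). [cite: KontsevichZagier2001, §1.2 Conjecture 1] -/
theorem stub_boxRigidity_var2342_iff_le_four :
    (∀ (m m' : ℕ) (N : IntegralRep m) (N' : IntegralRep m'), m ≤ 4 → m' ≤ 2 → N.domain = {x | ∀ i, x i ∈ Set.Ioo (0:ℝ) 1} → N.IsRational → N'.domain = {x | ∀ i, x i ∈ Set.Ioo (0:ℝ) 1} → N'.IsRational → N.value = N'.value → Equivalent N N') ↔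
    (∀ (m m' : ℕ) (N : IntegralRep m) (N' : IntegralRep m'), m ≤ 4 → m' ≤ 4 →
      N.domain = {x | ∀ i, x i ∈ Set.Ioo (0:ℝ) 1} → N.IsRational →
      N'.domain = {x | ∀ i, x i ∈ Set.Ioo (0:ℝ) 1} → N'.IsRational →
      N.value = N'.value → Equivalent N N') :=
  boxRigidityLe_iff_max 4 2

/-- **V2342 ⟺ BoxVanishing in the single dimension `4`**: every box-rational representation on
`(0,1)⁴` of value `0` is a relation (lower dimensions pad into `(0,1)⁴` by unit intervals,
`boxRigidityLe_iff_boxVanishingAt 4`). [cite: KontsevichZagier2001, §1.2 Conjecture 1] -/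
theorem stub_boxRigidity_var2342_iff_boxVanishing_four :
    (∀ (m m' : ℕ) (N : IntegralRep m) (N' : IntegralRep m'), m ≤ 4 → m' ≤ 2 → N.domain = {x | ∀ i, x i ∈ Set.Ioo (0:ℝ) 1} → N.IsRational → N'.domain = {x | ∀ i, x i ∈ Set.Ioo (0:ℝ) 1} → N'.IsRational → N.value = N'.value → Equivalent N N') ↔
    (∀ (M : IntegralRep 4), M.domain = {x | ∀ i, x i ∈ Set.Ioo (0:ℝ) 1} → M.IsRational →
      M.value = 0 → of M ∈ relations) :=
  (boxRigidityLe_iff_max 4 2).trans (boxRigidityLe_iff_boxVanishingAt 4)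

/-- **V2342 ⇒ BoxVanishing in dimension `2`** (the first open dimension: every `ℚ`-linear relation
among the box periods `∫∫_{(0,1)²} p/q` — `π log 2`, `log² 2`, Catalan's `G`, `Li₂` and Clausen
values — would have to be produced by moves). [cite: KontsevichZagier2001, §1.2 Conjecture 1] -/
theorem boxVanishing_two_of_stub_boxRigidity_var2342
    (h : ∀ (m m' : ℕ) (N : IntegralRep m) (N' : IntegralRep m'), m ≤ 4 → m' ≤ 2 → N.domain = {x | ∀ i, x i ∈ Set.Ioo (0:ℝ) 1} → N.IsRational → N'.domain = {x | ∀ i, x i ∈ Set.Ioo (0:ℝ) 1} → N'.IsRational → N.value = N'.value → Equivalent N N')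
    (N : IntegralRep 2) (hNd : N.domain = {x | ∀ i, x i ∈ Set.Ioo (0:ℝ) 1}) (hNr : N.IsRational)
    (hv : N.value = 0) : of N ∈ relations :=
  stub_boxRigidity_var2342_iff_boxVanishingLe_four.1 h 2 N (by norm_num) hNd hNr hv

/-- **V2342 ⇒ V2340** (the rung `≤ 3`, recorded open): BoxVanishing(dim ≤ 4) ⇒ BoxVanishing(dim ≤ 3).
[cite: KontsevichZagier2001, §1.2 Conjecture 1] -/
theorem stub_boxRigidity_var2340_of_var2342
    (h : ∀ (m m' : ℕ) (N : IntegralRep m) (N' : IntegralRep m'), m ≤ 4 → m' ≤ 2 → N.domain = {x | ∀ i, x i ∈ Set.Ioo (0:ℝ) 1} → N.IsRational → N'.domain = {x | ∀ i, x i ∈ Set.Ioo (0:ℝ) 1} → N'.IsRational → N.value = N'.value → Equivalent N N') :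
    ∀ (m m' : ℕ) (N : IntegralRep m) (N' : IntegralRep m'), m ≤ 3 → m' ≤ 2 → N.domain = {x | ∀ i, x i ∈ Set.Ioo (0:ℝ) 1} → N.IsRational → N'.domain = {x | ∀ i, x i ∈ Set.Ioo (0:ℝ) 1} → N'.IsRational → N.value = N'.value → Equivalent N N' :=
  fun m m' N N' hm hm' => h m m' N N' (hm.trans (by norm_num)) hm'

/-! ## The other side: the variant is implied by the Summit -/

/-- **The parent leaf ⇒ V2342** (specialisation; the converse is not claimed — the parent is
BoxVanishing in ALL dimensions, `boxRigidity_iff_forall_boxVanishingLe`).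
[cite: KontsevichZagier2001, §1.2 Conjecture 1] -/
theorem stub_boxRigidity_var2342_of_parent
    (h : ∀ (m m' : ℕ) (N : IntegralRep m) (N' : IntegralRep m'), N.domain = {x | ∀ i, x i ∈ Set.Ioo (0:ℝ) 1} → N.IsRational → N'.domain = {x | ∀ i, x i ∈ Set.Ioo (0:ℝ) 1} → N'.IsRational → N.value = N'.value → Equivalent N N') :
    ∀ (m m' : ℕ) (N : IntegralRep m) (N' : IntegralRep m'), m ≤ 4 → m' ≤ 2 → N.domain = {x | ∀ i, x i ∈ Set.Ioo (0:ℝ) 1} → N.IsRational → N'.domain = {x | ∀ i, x i ∈ Set.Ioo (0:ℝ) 1} → N'.IsRational → N.value = N'.value → Equivalent N N' :=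
  fun m m' N N' _ _ => h m m' N N'

/-- **`KontsevichZagierPeriods ⇒ V2342`**: the variant is a special case of Conjecture 1 for the
tree's calculus (`leaves_of_statement`) — a refutation of the variant would refute the Summit.
[cite: KontsevichZagier2001, §1.2 Conjecture 1] -/
theorem stub_boxRigidity_var2342_of_statement (h : _root_.KontsevichZagierPeriods) :
    ∀ (m m' : ℕ) (N : IntegralRep m) (N' : IntegralRep m'), m ≤ 4 → m' ≤ 2 → N.domain = {x | ∀ i, x i ∈ Set.Ioo (0:ℝ) 1} → N.IsRational → N'.domain = {x | ∀ i, x i ∈ Set.Ioo (0:ℝ) 1} → N'.IsRational → N.value = N'.value → Equivalent N N' :=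
  stub_boxRigidity_var2342_of_parent (leaves_of_statement h).1

end Summit.KontsevichZagierPeriods.KontsevichZagierPeriods.Theorems
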